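import Summits.QuantumFields.YangMills.Theorems.BalabanUVNodesN15CurvedGluingCubeDressedGeneralCommutatorAdjoint
import HarnessLib

/-!
# THE ADJOINT SPECIES COMMUTATOR `G∘[V(C,A) + N, M_h]` FROM SANDWICHED RIGHT ENTRIES — dag-n15-w3 file 14 ∕ dag-n15-w5's adjoint row with the cube's right entries `G∘∇^±_μ` entering ONLY behind an
# interior cut, `G∘∇^±_μ∘M_χ = T^±_μ∘M_χ` (the shape dag-n15-a's Neumann-by-images cube and FILE 148's adjoint-form dressed cube deliver) (dag-n15-c g18, FILE 152; N15 = NE2, s1)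

Cell `pub-ymgap`, seat `pub-ymgap-dag-n15-c` (R134 (a); HUMAN RULING D-0062), generation 18.  `bears_on: R4∕N15 · K3⁸ SpineGivenEndpointR13SepCoPHV (stmt-QuantumFields-27366)`.
Filed `--kind proof --supports stmt-QuantumFields-27366 --as helper` — COUNT-NEUTRAL.  Theorems only; 0 `def`, 0 `sorry`.  Imports BY NAME dag-n15-w5 `…CurvedGluingCubeDressedGeneralCommutatorAdjoint`
(`unstackM_add_base_comp_jet`; through it dag-n15-w3 file 14 `…CurvedGluingSpeciesCommutatorAdjoint` (`comp_commOp_speciesOpM`, `sum_abs_smul_row_le`, `hasMaj_comp_mmulOp_loc`), dag-n15-c FILE 56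
`hasMaj_commOp_nonlocal`, FILE 57 `hasMaj_comp_commOp_of_add`).  Nothing in the tree is modified; nothing of dag-n15-w3∕w5's restated (their theorems are the unsandwiched editions).

WHY.  The adjoint remainder row of a cube `G_□∘[Δ, M_{h_□}]` (FILE 147's `hKc`) contains, for `Δ = Δ_flat + N_L − 𝒱`, the species half `G_□∘[V(C,A), M_h]`; dag-n15-w3 file 14 wrote it
EXACTLY through the cube's right entries followed by diagonal factors (`comp_commOp_speciesOpM`: `Σ_μ[G∘M_{∇⁻h·A⁺′} + (G∘∇⁺_μ)∘M_{δ⁻h·A⁺′} + G∘M_{∇⁺h·A⁻′} − (G∘∇⁻_μ)∘M_{δ⁺h·A⁻′}]`, no derivative of `A`).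
For the cubes of the adjoint programme the right entries exist only SANDWICHED (dag-n15-a N-IIn (a)±: the source cut does not commute with a quotient; FILE 148: `X∘Q = Ñ_𝒲∘(G₀∘Q)` with
`G₀∘∇^±` sandwiched).  But the diagonal factors `M_{δ^∓h·A}` are supported in the transition layer of `h`, i.e. where the interior cut `χ ≡ 1`: `M_{δh·A} = M_χ∘M_{δh·A}`, so
`(G∘∇^±)∘M_{δh·A} = (G∘∇^±∘M_χ)∘M_{δh·A} = T^±∘M_{δh·A}` — the sandwiched identity suffices, verbatim as in g13's flat edition `hasMaj_comp_commOp_lapOp_of_sandwich` (FILE 94).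

WHAT.  §1 `mulOp_comp_mmulOp_smul_of_support` (`M_χ∘M_{w·B} = M_{w·B}` when `χ = 1` on `supp w`), `comp_mmulOp_smul_of_sandwich` (`(G∘Q)∘M_{w·B} = T∘M_{w·B}` from `G∘Q∘M_χ = T∘M_χ`).  §2 ★★
`hasMaj_comp_commOp_speciesOpM_of_sandwich` (`G∘[V, M_h] ≤ 1_S1_S·|J|·2r_A(c₁β + c₀β₁)e^{−δd}` from `G ≤ 1_S1_Sβ`, sandwiched `T^± ≤ 1_S1_Sβ₁`, `|∇^±h| ≤ c₁`, `|δ^±h| ≤ c₀`, `Σ_k|A_{ik}| ≤ r_A`, and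
`χ = 1` on `supp δ^±h` — file 14's constant), ★★ `hasMaj_comp_commOp_speciesOpM_add_of_sandwich` (+ the base part `N ≤ R_Ne^{−δ_Nd}` through FILE 56∕57 — dag-n15-w5's constant), ★
`hasMaj_comp_commOp_dressedPert_of_sandwich` (read on the dressed perturbation `(unstackM C A + N∘pr₀)∘jet`).  The two-grid twins are the verbatim `idef` editions (next file).

HONEST FRAMING ∕ LIMITS.  Finite-dimensional operator algebra + block-majorant bookkeeping over DISPLAYED letters; proves NO estimate of any concrete propagator; nothing of [B5]∕[B6]∕[B9]
asserted ((1.126)–(1.128), (2.91)–(2.92) p.239, (2.133)–(2.134) p.247, (3.52) p.400, (3.76)–(3.77) pp.405–406 = SHAPES ∕ MECHANISM).  NE2⁺ NOT PRINTED, NOT proved; N15 NOT discharged; K3⁸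
OPEN, skeleton v7 untouched (0∕2); counts of record UNMOVED by this seat (typed 28∕28 · discharged 7∕28 = 7∕27 excl. NODE O, №245); one finite 𝕋⁴ at fixed ε — NOT infinite volume, NOT OS on ℝ⁴, NOT a mass gap, NOT Clay;
R4 closes the conditional finite-𝕋⁴ rung `BalabanLadder.UV` only.  Restate-immune (no Theses import).
-/

set_option autoImplicit false

noncomputable section
open scoped BigOperators
open Finset

namespace Summit.QuantumFields.YangMills.BalabanUVNodes.N15.Gluing

open Literature.MathematicalPhysics.QuantumFieldTheory.Balaban1983to89
open Literature.MathematicalPhysics.QuantumFieldTheory.Balaban1983to89.B11SectG (BlockNorm HasMaj RowSum)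
open Literature.MathematicalPhysics.QuantumFieldTheory.Balaban1983to89.B6RandomWalk (Triangle254)
open Literature.MathematicalPhysics.QuantumFieldTheory.Balaban1983to89.B6Prop26Gluing (mulOp mulOp_apply ind ind_nonneg)
open Summit.QuantumFields.YangMills.BalabanUVNodes.N15.MatrixSpecies (mmulOp mmulOp_apply liftBlk liftEquiv liftEquiv_apply liftEquiv_symm_apply hasMaj_mmulOp)
open Summit.QuantumFields.YangMills.BalabanUVNodes.N15.BackgroundLayer (fgrad bgrad fgrad_apply bgrad_apply speciesOpM stack projO unstackM)
open Summit.QuantumFields.YangMills.BalabanUVNodes.N15.CurvedSpecies (comp_commOp_speciesOpM sum_abs_smul_row_le hasMaj_comp_mmulOp_loc unstackM_add_base_comp_jet)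

/-! ## §1 A diagonal factor supported where the interior cut is `1` absorbs the cut; the sandwich passes to it -/

section Support

variable {X ι : Type} [Fintype ι] {χX w : X → ℝ} {B : X → Matrix ι ι ℝ}

/-- `M_χ∘M_{w·B} = M_{w·B}` when `χ = 1` on `supp w`. [folklore] -/
theorem mulOp_comp_mmulOp_smul_of_support (hw : ∀ x, w x ≠ 0 → χX x = 1) :
    mulOp (fun p : X × ι => χX p.1) ∘ₗ mmulOp (fun x => w x • B x) = mmulOp (fun x => w x • B x) := by
  refine LinearMap.ext fun f => funext fun p => ?_
  simp only [LinearMap.comp_apply, mulOp_apply, mmulOp_apply, Matrix.smul_apply, smul_eq_mul]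
  by_cases h0 : w p.1 = 0
  · simp [h0]
  · rw [hw p.1 h0, one_mul]

/-- THE SANDWICH PASSES TO THE DIAGONAL FACTOR: `G∘Q∘M_χ = T∘M_χ` and `χ = 1` on `supp w` ⟹ `(G∘Q)∘M_{w·B} = T∘M_{w·B}`. [cite: Balaban1984PropagatorsII, (2.133) p.247 («y′ ∈ 𝔅 ∩ T_□»: shape)] -/
theorem comp_mmulOp_smul_of_sandwich {G Q T : (X × ι → ℝ) →ₗ[ℝ] (X × ι → ℝ)} (hs : G ∘ₗ Q ∘ₗ mulOp (fun p : X × ι => χX p.1) = T ∘ₗ mulOp (fun p : X × ι => χX p.1))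
    (hw : ∀ x, w x ≠ 0 → χX x = 1) :
    (G ∘ₗ Q) ∘ₗ mmulOp (fun x => w x • B x) = T ∘ₗ mmulOp (fun x => w x • B x) := by
  calc (G ∘ₗ Q) ∘ₗ mmulOp (fun x => w x • B x) = (G ∘ₗ Q) ∘ₗ (mulOp (fun p : X × ι => χX p.1) ∘ₗ mmulOp (fun x => w x • B x)) := by
        rw [mulOp_comp_mmulOp_smul_of_support (B := B) hw]
    _ = (G ∘ₗ Q ∘ₗ mulOp (fun p : X × ι => χX p.1)) ∘ₗ mmulOp (fun x => w x • B x) := by simp only [LinearMap.comp_assoc]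
    _ = T ∘ₗ (mulOp (fun p : X × ι => χX p.1) ∘ₗ mmulOp (fun x => w x • B x)) := by rw [hs, LinearMap.comp_assoc]
    _ = T ∘ₗ mmulOp (fun x => w x • B x) := by rw [mulOp_comp_mmulOp_smul_of_support (B := B) hw]

end Support

/-! ## §2 The adjoint species commutator from sandwiched right entries -/

section Rows

variable {X ι J : Type} [Fintype X] [Fintype ι] [Fintype J] {g : B6.Geometry} (blk : X → g.Site) (τ : J → X ≃ X) (n : ℝ) (C : X → Matrix ι ι ℝ) (A : J ⊕ J → X → Matrix ι ι ℝ)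
  (hX : X → ℝ) (G : (X × ι → ℝ) →ₗ[ℝ] (X × ι → ℝ)) {χX : X → ℝ} {TD TB : J → (X × ι → ℝ) →ₗ[ℝ] (X × ι → ℝ)} {σ cr : ℝ}

/-- ★★ **THE ADJOINT SPECIES COMMUTATOR FROM SANDWICHED RIGHT ENTRIES**: `G ≤ 1_S(y)1_S(y′)·βe^{−δd}`, the SANDWICHED right entries `G∘∇⁺_μ∘M_χ = T⁺_μ∘M_χ`, `G∘∇⁻_μ∘M_χ = T⁻_μ∘M_χ` with
`T^±_μ ≤ 1_S1_S·β₁e^{−δd}`, the interior cut `χ = 1` on the transition layers `{h ≠ h∘τ_μ⁻¹}`, `{h∘τ_μ ≠ h}`, the partition letters `|∇^±_μh| ≤ c₁`, `|h∘τ_μ − h| ≤ c₀`, the coefficient rows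
`Σ_k|A^±_μ(x)_{ik}| ≤ r_A` ⟹ `G∘[V(C,A), M_h] ≤ 1_S(y)1_S(y′)·|J|·2r_A(c₁β + c₀β₁)·e^{−δd}` — dag-n15-w3 file 14's letter. [cite: Balaban1984PropagatorsII, (2.134) p.247 (shape, transposed), (2.91)–(2.92) p.239 (mechanism); Balaban1985BackgroundPropagators, (3.52) p.400 (shape)] -/
theorem hasMaj_comp_commOp_speciesOpM_of_sandwich {S : Set g.Site} {β β₁ c₁ c₀ rA δ : ℝ} (hβ : 0 ≤ β) (hβ₁ : 0 ≤ β₁) (hc₁ : 0 ≤ c₁) (hc₀ : 0 ≤ c₀) (hrA : 0 ≤ rA)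
    (hh1 : ∀ μ x, |fgrad n (τ μ) hX x| ≤ c₁) (hh1b : ∀ μ x, |bgrad n (τ μ) hX x| ≤ c₁) (hh0 : ∀ μ x, |hX (τ μ x) - hX x| ≤ c₀) (hA : ∀ j x i, ∑ k, |A j x i k| ≤ rA)
    (hδf : ∀ μ x, hX x - hX ((τ μ).symm x) ≠ 0 → χX x = 1) (hδb : ∀ μ x, hX (τ μ x) - hX x ≠ 0 → χX x = 1)
    (hsD : ∀ μ, G ∘ₗ fgrad n (liftEquiv (τ μ) ι) ∘ₗ mulOp (fun p : X × ι => χX p.1) = TD μ ∘ₗ mulOp (fun p : X × ι => χX p.1))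
    (hsB : ∀ μ, G ∘ₗ bgrad n (liftEquiv (τ μ) ι) ∘ₗ mulOp (fun p : X × ι => χX p.1) = TB μ ∘ₗ mulOp (fun p : X × ι => χX p.1))
    (hG : HasMaj (BlockNorm.ofBlocks g (liftBlk blk ι)) (BlockNorm.ofBlocks g (liftBlk blk ι)) G (fun y y' => ind S y * ind S y' * (β * Real.exp (-(δ * g.dist y y')))))
    (hTD : ∀ μ, HasMaj (BlockNorm.ofBlocks g (liftBlk blk ι)) (BlockNorm.ofBlocks g (liftBlk blk ι)) (TD μ) (fun y y' => ind S y * ind S y' * (β₁ * Real.exp (-(δ * g.dist y y')))))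
    (hTB : ∀ μ, HasMaj (BlockNorm.ofBlocks g (liftBlk blk ι)) (BlockNorm.ofBlocks g (liftBlk blk ι)) (TB μ) (fun y y' => ind S y * ind S y' * (β₁ * Real.exp (-(δ * g.dist y y'))))) :
    HasMaj (BlockNorm.ofBlocks g (liftBlk blk ι)) (BlockNorm.ofBlocks g (liftBlk blk ι)) (G ∘ₗ commOp (speciesOpM τ n C A) (fun p : X × ι => hX p.1))
      (fun y y' => ind S y * ind S y' * ((Fintype.card J * (2 * rA * (c₁ * β + c₀ * β₁))) * Real.exp (-(δ * g.dist y y')))) := by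
  have hh0b : ∀ μ x, |hX x - hX ((τ μ).symm x)| ≤ c₀ := fun μ x => by simpa using hh0 μ ((τ μ).symm x)
  have r1f : ∀ μ x i, ∑ k, |(bgrad n (τ μ) hX x • A (Sum.inl μ) ((τ μ).symm x)) i k| ≤ c₁ * rA := fun μ x i => sum_abs_smul_row_le hc₁ (hh1b μ x) i (hA _ _ i)
  have r2f : ∀ μ x i, ∑ k, |((hX x - hX ((τ μ).symm x)) • A (Sum.inl μ) ((τ μ).symm x)) i k| ≤ c₀ * rA := fun μ x i => sum_abs_smul_row_le hc₀ (hh0b μ x) i (hA _ _ i)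
  have r1b : ∀ μ x i, ∑ k, |(fgrad n (τ μ) hX x • A (Sum.inr μ) (τ μ x)) i k| ≤ c₁ * rA := fun μ x i => sum_abs_smul_row_le hc₁ (hh1 μ x) i (hA _ _ i)
  have r2b : ∀ μ x i, ∑ k, |((hX (τ μ x) - hX x) • A (Sum.inr μ) (τ μ x)) i k| ≤ c₀ * rA := fun μ x i => sum_abs_smul_row_le hc₀ (hh0 μ x) i (hA _ _ i)
  -- the sandwiches pass to the diagonal factors of the transition layers
  have eD : ∀ μ, (G ∘ₗ fgrad n (liftEquiv (τ μ) ι)) ∘ₗ mmulOp (fun x => (hX x - hX ((τ μ).symm x)) • A (Sum.inl μ) ((τ μ).symm x)) =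
      TD μ ∘ₗ mmulOp (fun x => (hX x - hX ((τ μ).symm x)) • A (Sum.inl μ) ((τ μ).symm x)) := fun μ => comp_mmulOp_smul_of_sandwich (hsD μ) (hδf μ)
  have eB : ∀ μ, (G ∘ₗ bgrad n (liftEquiv (τ μ) ι)) ∘ₗ mmulOp (fun x => (hX (τ μ x) - hX x) • A (Sum.inr μ) (τ μ x)) =
      TB μ ∘ₗ mmulOp (fun x => (hX (τ μ x) - hX x) • A (Sum.inr μ) (τ μ x)) := fun μ => comp_mmulOp_smul_of_sandwich (hsB μ) (hδb μ)
  have hterm : ∀ μ, HasMaj (BlockNorm.ofBlocks g (liftBlk blk ι)) (BlockNorm.ofBlocks g (liftBlk blk ι))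
      (G ∘ₗ mmulOp (fun x => bgrad n (τ μ) hX x • A (Sum.inl μ) ((τ μ).symm x)) +
          (G ∘ₗ fgrad n (liftEquiv (τ μ) ι)) ∘ₗ mmulOp (fun x => (hX x - hX ((τ μ).symm x)) • A (Sum.inl μ) ((τ μ).symm x)) +
        (G ∘ₗ mmulOp (fun x => fgrad n (τ μ) hX x • A (Sum.inr μ) (τ μ x)) -
          (G ∘ₗ bgrad n (liftEquiv (τ μ) ι)) ∘ₗ mmulOp (fun x => (hX (τ μ x) - hX x) • A (Sum.inr μ) (τ μ x))))
      (fun y y' => ind S y * ind S y' * ((2 * rA * (c₁ * β + c₀ * β₁)) * Real.exp (-(δ * g.dist y y')))) := fun μ => by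
    have f1 := hasMaj_comp_mmulOp_loc blk hβ (by positivity) (r1f μ) hG
    have f2 := hasMaj_comp_mmulOp_loc blk hβ₁ (by positivity) (r2f μ) (hTD μ)
    have b1 := hasMaj_comp_mmulOp_loc blk hβ (by positivity) (r1b μ) hG
    have b2 := hasMaj_comp_mmulOp_loc blk hβ₁ (by positivity) (r2b μ) (hTB μ)
    rw [eD μ, eB μ]
    refine ((f1.add f2).add (b1.sub b2)).mono fun y y' => le_of_eq ?_
    ring
  rw [comp_commOp_speciesOpM]
  refine (hasMaj_fsum (b₁ := BlockNorm.ofBlocks g (liftBlk blk ι)) (b₃ := BlockNorm.ofBlocks g (liftBlk blk ι)) Finset.univ _ _ fun μ _ => hterm μ).mono fun y y' => le_of_eq ?_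
  simp only [Finset.sum_const, Finset.card_univ, nsmul_eq_mul]
  ring

/-- ★★ **THE ADJOINT ROW OF `V(C,A) + N` FROM SANDWICHED RIGHT ENTRIES, OUTPUT-LOCALIZED** (dag-n15-w5 `hasMaj_comp_commOp_speciesOpM_add`'s sandwich edition): ★★ above + the base part
`N ≤ R_Ne^{−δ_Nd}` through FILE 56 `hasMaj_commOp_nonlocal` (`h` within `ω` of an `ℓ`-block-Lipschitz block constant, `ε > 0`, symmetric distance) and FILE 57 `hasMaj_comp_commOp_of_add` ⟹
`G∘[V(C,A) + N, M_h] ≤ 1_S(y)·(|J|·2r_A(c₁β + c₀β₁) + β(ℓ(eε)⁻¹ + 2ω)R_Nc_r)·e^{−ρd}` (`0 ≤ ρ ≤ δ_N − ε`, `ρ + σ ≤ δ`). [cite: Balaban1984PropagatorsI, (1.120)–(1.121) p.37, (1.128) p.38, p.39 (adjoint representation); Balaban1984PropagatorsII, (2.134) p.247; Balaban1985BackgroundPropagators, (3.52) p.400, (3.76)–(3.77) pp.405–406 (shapes)] -/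
theorem hasMaj_comp_commOp_speciesOpM_add_of_sandwich (htri : Triangle254 g) (hd : ∀ a b : g.Site, 0 ≤ g.dist a b) (hsymm : ∀ y y', g.dist y y' = g.dist y' y) (hrow : RowSum g σ cr)
    (hσ : 0 ≤ σ) {N : (X × ι → ℝ) →ₗ[ℝ] (X × ι → ℝ)} {S : Set g.Site} {hb : g.Site → ℝ} {β β₁ c₁ c₀ rA RN δ δN ε ℓ ω ρ : ℝ} (hβ : 0 ≤ β) (hβ₁ : 0 ≤ β₁) (hc₁ : 0 ≤ c₁)
    (hc₀ : 0 ≤ c₀) (hrA : 0 ≤ rA) (hRN : 0 ≤ RN) (hℓ : 0 ≤ ℓ) (hω : 0 ≤ ω) (hε : 0 < ε) (hρ : 0 ≤ ρ) (hρN : ρ ≤ δN - ε) (hρδ : ρ + σ ≤ δ)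
    (hh1 : ∀ μ x, |fgrad n (τ μ) hX x| ≤ c₁) (hh1b : ∀ μ x, |bgrad n (τ μ) hX x| ≤ c₁) (hh0 : ∀ μ x, |hX (τ μ x) - hX x| ≤ c₀)
    (hLip : ∀ y y', |hb y - hb y'| ≤ ℓ * g.dist y y') (hrh : ∀ x, |hX x - hb (blk x)| ≤ ω) (hA : ∀ j x i, ∑ k, |A j x i k| ≤ rA)
    (hδf : ∀ μ x, hX x - hX ((τ μ).symm x) ≠ 0 → χX x = 1) (hδb : ∀ μ x, hX (τ μ x) - hX x ≠ 0 → χX x = 1)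
    (hsD : ∀ μ, G ∘ₗ fgrad n (liftEquiv (τ μ) ι) ∘ₗ mulOp (fun p : X × ι => χX p.1) = TD μ ∘ₗ mulOp (fun p : X × ι => χX p.1))
    (hsB : ∀ μ, G ∘ₗ bgrad n (liftEquiv (τ μ) ι) ∘ₗ mulOp (fun p : X × ι => χX p.1) = TB μ ∘ₗ mulOp (fun p : X × ι => χX p.1))
    (hG : HasMaj (BlockNorm.ofBlocks g (liftBlk blk ι)) (BlockNorm.ofBlocks g (liftBlk blk ι)) G (fun y y' => ind S y * ind S y' * (β * Real.exp (-(δ * g.dist y y')))))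
    (hTD : ∀ μ, HasMaj (BlockNorm.ofBlocks g (liftBlk blk ι)) (BlockNorm.ofBlocks g (liftBlk blk ι)) (TD μ) (fun y y' => ind S y * ind S y' * (β₁ * Real.exp (-(δ * g.dist y y')))))
    (hTB : ∀ μ, HasMaj (BlockNorm.ofBlocks g (liftBlk blk ι)) (BlockNorm.ofBlocks g (liftBlk blk ι)) (TB μ) (fun y y' => ind S y * ind S y' * (β₁ * Real.exp (-(δ * g.dist y y')))))
    (hN : HasMaj (BlockNorm.ofBlocks g (liftBlk blk ι)) (BlockNorm.ofBlocks g (liftBlk blk ι)) N (fun y y' => RN * Real.exp (-(δN * g.dist y y')))) :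
    HasMaj (BlockNorm.ofBlocks g (liftBlk blk ι)) (BlockNorm.ofBlocks g (liftBlk blk ι)) (G ∘ₗ commOp (speciesOpM τ n C A + N) (fun p : X × ι => hX p.1))
      (fun y y' => ind S y * ((Fintype.card J * (2 * rA * (c₁ * β + c₀ * β₁)) + β * ((ℓ * (Real.exp 1 * ε)⁻¹ + 2 * ω) * RN) * cr) * Real.exp (-(ρ * g.dist y y')))) := by
  have hKloc := hasMaj_comp_commOp_speciesOpM_of_sandwich blk τ n C A hX G hβ hβ₁ hc₁ hc₀ hrA hh1 hh1b hh0 hA hδf hδb hsD hsB hG hTD hTB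
  have hKN := hasMaj_commOp_nonlocal (liftBlk blk ι) (h := fun p : X × ι => hX p.1) hRN hℓ hω hε hd hsymm hLip (fun p => hrh p.1) hN
  have hθ₁ : 0 ≤ Fintype.card J * (2 * rA * (c₁ * β + c₀ * β₁)) := by positivity
  have hcK : 0 ≤ (ℓ * (Real.exp 1 * ε)⁻¹ + 2 * ω) * RN := by positivity
  exact hasMaj_comp_commOp_of_add (liftBlk blk ι) htri hd hrow hσ hθ₁ hcK hβ hρ hρN hρδ hKloc hKN hG

/-- ★ **… READ ON THE DRESSED PERTURBATION** `𝒱 = (unstackM C A + N∘pr₀)∘jet` (dag-n15-w5 `unstackM_add_base_comp_jet`): `G∘[𝒱, M_h]` has the same letter — FILE 147's `hKc` species half for an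
adjoint-side dressed cube with uncut structural perturbation. [cite: Balaban1985BackgroundPropagators, (3.52) p.400, (3.62)–(3.65) pp.402–403, (3.76)–(3.77) pp.405–406 (shapes)] -/
theorem hasMaj_comp_commOp_dressedPert_of_sandwich [DecidableEq ι] [DecidableEq J] (htri : Triangle254 g) (hd : ∀ a b : g.Site, 0 ≤ g.dist a b) (hsymm : ∀ y y', g.dist y y' = g.dist y' y)
    (hrow : RowSum g σ cr) (hσ : 0 ≤ σ) {N : (X × ι → ℝ) →ₗ[ℝ] (X × ι → ℝ)} {S : Set g.Site} {hb : g.Site → ℝ} {β β₁ c₁ c₀ rA RN δ δN ε ℓ ω ρ : ℝ} (hβ : 0 ≤ β) (hβ₁ : 0 ≤ β₁)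
    (hc₁ : 0 ≤ c₁) (hc₀ : 0 ≤ c₀) (hrA : 0 ≤ rA) (hRN : 0 ≤ RN) (hℓ : 0 ≤ ℓ) (hω : 0 ≤ ω) (hε : 0 < ε) (hρ : 0 ≤ ρ) (hρN : ρ ≤ δN - ε) (hρδ : ρ + σ ≤ δ)
    (hh1 : ∀ μ x, |fgrad n (τ μ) hX x| ≤ c₁) (hh1b : ∀ μ x, |bgrad n (τ μ) hX x| ≤ c₁) (hh0 : ∀ μ x, |hX (τ μ x) - hX x| ≤ c₀)
    (hLip : ∀ y y', |hb y - hb y'| ≤ ℓ * g.dist y y') (hrh : ∀ x, |hX x - hb (blk x)| ≤ ω) (hA : ∀ j x i, ∑ k, |A j x i k| ≤ rA)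
    (hδf : ∀ μ x, hX x - hX ((τ μ).symm x) ≠ 0 → χX x = 1) (hδb : ∀ μ x, hX (τ μ x) - hX x ≠ 0 → χX x = 1)
    (hsD : ∀ μ, G ∘ₗ fgrad n (liftEquiv (τ μ) ι) ∘ₗ mulOp (fun p : X × ι => χX p.1) = TD μ ∘ₗ mulOp (fun p : X × ι => χX p.1))
    (hsB : ∀ μ, G ∘ₗ bgrad n (liftEquiv (τ μ) ι) ∘ₗ mulOp (fun p : X × ι => χX p.1) = TB μ ∘ₗ mulOp (fun p : X × ι => χX p.1))
    (hG : HasMaj (BlockNorm.ofBlocks g (liftBlk blk ι)) (BlockNorm.ofBlocks g (liftBlk blk ι)) G (fun y y' => ind S y * ind S y' * (β * Real.exp (-(δ * g.dist y y')))))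
    (hTD : ∀ μ, HasMaj (BlockNorm.ofBlocks g (liftBlk blk ι)) (BlockNorm.ofBlocks g (liftBlk blk ι)) (TD μ) (fun y y' => ind S y * ind S y' * (β₁ * Real.exp (-(δ * g.dist y y')))))
    (hTB : ∀ μ, HasMaj (BlockNorm.ofBlocks g (liftBlk blk ι)) (BlockNorm.ofBlocks g (liftBlk blk ι)) (TB μ) (fun y y' => ind S y * ind S y' * (β₁ * Real.exp (-(δ * g.dist y y')))))
    (hN : HasMaj (BlockNorm.ofBlocks g (liftBlk blk ι)) (BlockNorm.ofBlocks g (liftBlk blk ι)) N (fun y y' => RN * Real.exp (-(δN * g.dist y y')))) :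
    HasMaj (BlockNorm.ofBlocks g (liftBlk blk ι)) (BlockNorm.ofBlocks g (liftBlk blk ι))
      (G ∘ₗ commOp ((unstackM C A + N ∘ₗ projO none) ∘ₗ
        stack LinearMap.id (fun j : J ⊕ J => Sum.elim (fun μ => fgrad n (liftEquiv (τ μ) ι)) (fun μ => bgrad n (liftEquiv (τ μ) ι)) j)) (fun p : X × ι => hX p.1))
      (fun y y' => ind S y * ((Fintype.card J * (2 * rA * (c₁ * β + c₀ * β₁)) + β * ((ℓ * (Real.exp 1 * ε)⁻¹ + 2 * ω) * RN) * cr) * Real.exp (-(ρ * g.dist y y')))) := by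
  rw [unstackM_add_base_comp_jet]
  exact hasMaj_comp_commOp_speciesOpM_add_of_sandwich blk τ n C A hX G htri hd hsymm hrow hσ hβ hβ₁ hc₁ hc₀ hrA hRN hℓ hω hε hρ hρN hρδ hh1 hh1b hh0 hLip hrh hA hδf hδb hsD hsB hG hTD hTB hN

end Rows

end Summit.QuantumFields.YangMills.BalabanUVNodes.N15.Gluing

end
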